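import Summits.BirchSwinnertonDyer.BirchSwinnertonDyer.Theses.TwoAdicConverse
import Summits.BirchSwinnertonDyer.BirchSwinnertonDyer.Theorems.TwoAdicConverseGoodOrdinaryPub
import Summits.BirchSwinnertonDyer.BirchSwinnertonDyer.Theorems.GoldfeldGoodTwistsHalfHalf
import Literature.NumberTheory.EllipticCurves.BSDSelmerSmithProofs
import HarnessLib

/-!
# Route `TwoAdicConverse` (rung S3), crux `GoodOrdinaryRankZeroTwoConverse`: what the rank-`0`
# `2`-converse buys — the EVEN HALF OF GOLDFELD, WITH BSD, for the good quadratic twists of every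
# non-CM curve good ordinary at `2`

Cell `bsd-2adic` (run/shared/lean/pub/bsd-2adic/), seat `bsd-2adic-conv-1` (director-bsd D-0074 (A):
«19218 from the K4 halves + typed Smith 2025 inputs ⇒ the S3 rank statement for a.e. good-ordinary-at-2
E»). THEOREMS ONLY — no named fact, no axiom, no definition; every deep input is a named fact of the
tree or an OPEN route decl, carried as an explicit hypothesis.

**Objects.** `W / ℚ` a globally minimal NON-CM elliptic curve with good ORDINARY reduction at `2`
(`GoodOrd W 2`: `2 ∤ N`, `2 ∤ a_2`), and its quadratic twists `W^{(d)}` by the GOOD family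
`𝓕 = {d squarefree : d ≡ 1 (mod 4)}` — exactly the squarefree `d` with `ℚ(√d)/ℚ` unramified at `2`,
so that a minimal model `W'` of `W^{(d)}` is again non-CM and good ordinary at `2`
(`not_hasCM_and_goodOrd_of_smul_eq_quadraticTwist`, from the Goldfeld cell's local analysis
`GoldfeldGoodTwists.hasGoodReductionAtPrime_and_frobeniusTrace_of_smul_eq_quadraticTwist_two`:
`a_2(W') = ±a_2(W)`, and `j(W^{(d)}) = j(W)`). The class of the crux is CLOSED under `𝓕`.

**Main statements** (hypotheses: `hConv` = the crux
`Theses.TwoAdicConverse.GoodOrdinaryRankZeroTwoConverse` (item stmt-BirchSwinnertonDyer-19218, OPEN;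
equivalently its children 19167 + 19151 through the landed glue p416617); `hGZK` =
Gross–Zagier–Kolyvagin; `hS : smith_selmerCorank_density W` = Smith 2025 Thm. 1.1 for `W`;
`hmod : exists_isNewformOf` = Modularity; `hpar` / `hMon` = `2`-parity / Monsky's congruence):

* §1 ONE TWIST. `rankZero_bsd_quadraticTwist_of_selmerCorankTwoInfty_eq_zero`: `hConv`, `hGZK`,
  `d ∈ 𝓕`, `corank_{ℤ_2} Sel_{2^∞}(W^{(d)}) = 0` ⟹ `ord_{s=1} L(W^{(d)}, s) = rank W^{(d)}(ℚ) = 0` and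
  `Ш(W^{(d)}/ℚ)` finite; and on a good twist of corank `≤ 1` the rank-`0` triple is EQUIVALENT to
  `w(W^{(d)}) = +1` (`rankZero_bsd_iff_rootNumber_eq_one_of_selmerCorankTwoInfty_le_one`).
* §2 FROM THE CRUX ALONE (+ PRINT + Smith): `tendsto_familyProportion_rankZero` — among `d ∈ 𝓕`,
  `|d| ≤ X`, the proportion with `ord_{s=1} L(W^{(d)}, s) = rank W^{(d)}(ℚ) = 0 ∧ Ш(W^{(d)}/ℚ)` finite
  tends to EXACTLY `1/2` (the even half of Goldfeld's conjecture for `W` in `𝓕`, with BSD); and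
  `tendsto_familyProportion_rankZero_of_rootNumber` — for `100 %` of `d ∈ 𝓕`,
  `w(W^{(d)}) = +1 ⟹` the same triple. Mechanism: on Smith's density-`1` set `{corank ≤ 1}`,
  `w = +1` forces the corank to be even (Monsky), hence `0`, hence the triple (§1); conversely the
  triple gives corank `= rank = 0` and `w = (−1)^0`; root numbers equidistribute in `𝓕`
  (`GoldfeldGoodTwists.tendsto_familyProportion_rootNumber_eq_one`, Modularity).
* §3 THE SAME FROM THE K4 HALVES: `hConv` replaced by the crux's CHILDREN — the PUBLISHED conjunction
  `Literature.Uncategorized.OrdConversePublishedInputsAtTwo` (item 19167) and the Eisenstein half of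
  the `2`-adic main conjecture `Theorems.OrdHalvesAtTwo.OrdEisensteinHalfAtTwo` (item 19151, OPEN),
  via the landed bridge `goodOrdinaryRankZeroTwoConverse_of_facts_of_eisenstein` (p409493).
The companion file `TwoAdicConverseGoodTwistsGoldfeld` adds the route's residual `RankOneTwoConverse`
(rank BSD for `100 %` of `𝓕`, Goldfeld `50/50`) and the rung-leaf form.

HONEST FRAMING. Nothing here proves the crux, the residual, or BSD: the file records, kernel-checked,
the VALUE of item 19218 in Smith's currency. The non-CM `2`-converses are open
(every printed `p`-converse has `p` odd or `E` CM); Smith's Thm. 1.1 (arXiv:2503.17619), GZK,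
Modularity and Monsky are named facts of the tree taken as hypotheses, never discharged here. Says
nothing about `d ≢ 1 (mod 4)` (additive reduction at `2`, no door — I2). PARTITION (D-0054): none —
RANK axis (S3); companion formula cell X5@2 good-ord (B1·O1; 611 book230 classes; class = every
non-CM `E/ℚ` good ordinary at `2`), owner bsd-2adic. TWIN (D-0056): rank statement
`GoodOrdinaryRankZeroTwoConverse` ↔ row B1·O1 good-ord — p-part OPEN
(`X5.O1.MainConjectureEisensteinDivisibilityAtTwo` + Kato half), tree bridges p409439/p409493.

References: A. Smith, arXiv:2503.17619 (2025), Thm. 1.1, Cor. 1.2–1.3 [arXiv250317619]; A. Smith,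
J. Amer. Math. Soc. 39 (2026), Thm. 1.2 [Smith2022SelmerTwistI]; A. Burungale, Y. Tian, Ann. of
Math. 203 (2026), Thm. 1.2 and §3.2.1 (the CM template of §2) [BurungaleTian2026]; T. Dokchitser,
V. Dokchitser, Ann. of Math. 172 (2010), Thm. 1.4 (p = 2: Monsky 1996) [DokchitserDokchitserAnnals2010];
R. Greenberg, LNM 1716 (1999), §1, Thm. 4.1 [GreenbergLNM1716]; M. R. Murty, V. K. Murty (1997),
Ch. 6 §1 [MurtyMurty1997]; J. H. Silverman, *AEC* (2009), VII.1.3, X.5.4 [SilvermanAEC2009].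
-/

set_option linter.dupNamespace false
set_option autoImplicit false

noncomputable section

open scoped Classical

open Filter Topology WeierstrassCurve Literature.NumberTheory.EllipticCurves
  Literature.NumberTheory.EllipticCurves.ModularForms
  Literature.NumberTheory.EllipticCurves.Rank1Residual
  Summit.BirchSwinnertonDyer.BirchSwinnertonDyer.Theses.TwoAdicConverse
  Summit.BirchSwinnertonDyer.BirchSwinnertonDyer.Theorems.GoldfeldGoodTwists

namespace Summit.BirchSwinnertonDyer.BirchSwinnertonDyer.Theorems.TwoAdicGoodTwists

/-! ## §0 The class «non-CM, good ordinary at `2`» is closed under the good twists `d ≡ 1 (mod 4)` -/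

/-- **Good twists stay in the class.** For `W / ℚ` globally minimal, non-CM, good ordinary at `2`,
`d ≡ 1 (mod 4)` and a globally minimal `W'` with `C • W' = W^{(d)}`: `W'` is non-CM
(`j(W') = j(W^{(d)}) = j(W)` and `HasCM` depends only on `j`) and good ordinary at `2`
(`ℚ(√d)/ℚ` is unramified at `2`: `W'` has good reduction at `2` with `a_2(W') = ±a_2(W)`, the
Goldfeld cell's `hasGoodReductionAtPrime_and_frobeniusTrace_of_smul_eq_quadraticTwist_two`).
[cite: SilvermanAEC2009, VII.1 Prop. 1.3(b), X.5 Cor. 5.4, App. C §11] -/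
theorem not_hasCM_and_goodOrd_of_smul_eq_quadraticTwist
    (W W' : WeierstrassCurve ℚ) [W.IsElliptic] [W.IsGloballyMinimal] [W'.IsElliptic]
    [W'.IsGloballyMinimal] (hCM : ¬ W.HasCM) (hgo : GoodOrd W 2) {d : ℤ} (hd4 : d % 4 = 1)
    {C : VariableChange ℚ} (hC : C • W' = W.quadraticTwist (d : ℚ)) :
    ¬ W'.HasCM ∧ GoodOrd W' 2 := by
  have hd0 : ((d : ℤ) : ℚ) ≠ 0 := by exact_mod_cast (show d ≠ 0 by omega)
  haveI := W.isElliptic_quadraticTwist hd0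
  have hgo₀ : W.HasGoodReductionAtPrime 2 ∧ ¬ (2 : ℤ) ∣ W.frobeniusTrace 2 := hgo
  obtain ⟨hgood', htr⟩ :=
    hasGoodReductionAtPrime_and_frobeniusTrace_of_smul_eq_quadraticTwist_two W W' hd4 hC 2 rfl
      hgo₀.1
  refine ⟨fun hCM' => hCM ?_, ?_⟩
  · have h1 : (C • W').HasCM := hasCM_variableChange W' C hCM'
    rw [hC] at h1
    exact (hasCM_iff_of_j_eq (W.j_quadraticTwist hd0)).mp h1
  · show W'.HasGoodReductionAtPrime 2 ∧ ¬ (2 : ℤ) ∣ W'.frobeniusTrace 2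
    refine ⟨hgood', ?_⟩
    rw [htr]
    intro h
    apply hgo₀.2
    split_ifs at h
    · simpa using h
    · simpa using h

/-! ## §1 One good twist -/

/-- **Rank-`0` BSD for one good twist, from the crux.** Assume the rank-`0` `2`-converse
`GoodOrdinaryRankZeroTwoConverse` (`hConv`, item stmt-BirchSwinnertonDyer-19218, OPEN) and
Gross–Zagier–Kolyvagin (`hGZK`). For `W / ℚ` globally minimal, non-CM, good ordinary at `2`, and
`d ≡ 1 (mod 4)` with `corank_{ℤ_2} Sel_{2^∞}(W^{(d)}/ℚ) = 0`: `ord_{s=1} L(W^{(d)}, s) = 0`,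
`rank W^{(d)}(ℚ) = 0` and `Ш(W^{(d)}/ℚ)` is finite. Proof: a minimal model `W'` of `W^{(d)}`
(`exists_isGloballyMinimal_smul_eq_quadraticTwist`) is non-CM and good ordinary at `2` (§0) with
the same Selmer corank (`selmerCorank_eq_of_variableChange`); `hConv` gives `r_an(W') = 0`,
transported back by `analyticRank_smul`; then `hGZK`. [cite: arXiv250317619, §1 (the p-converse input of Cor. 1.2)]
[cite: GreenbergLNM1716, §1 pp. 54–57] -/
theorem rankZero_bsd_quadraticTwist_of_selmerCorankTwoInfty_eq_zero
    (hConv : GoodOrdinaryRankZeroTwoConverse) (hGZK : rank_eq_analyticRank_of_analyticRank_le_one)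
    (W : WeierstrassCurve ℚ) [W.IsElliptic] [W.IsGloballyMinimal] (hCM : ¬ W.HasCM)
    (hgo : GoodOrd W 2) {d : ℤ} (hd4 : d % 4 = 1)
    (h0 : selmerCorankTwoInfty (W.quadraticTwist d) = 0) :
    (W.quadraticTwist d).analyticRank = 0 ∧ (W.quadraticTwist d).mordellWeilRank = 0 ∧
      Finite (W.quadraticTwist d).sha := by
  have hd0 : ((d : ℤ) : ℚ) ≠ 0 := by exact_mod_cast (show d ≠ 0 by omega)
  haveI := W.isElliptic_quadraticTwist hd0
  obtain ⟨W', hW'ell, hW'min, C, hC⟩ := exists_isGloballyMinimal_smul_eq_quadraticTwist W hd0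
  obtain ⟨hCM', hgo'⟩ := not_hasCM_and_goodOrd_of_smul_eq_quadraticTwist W W' hCM hgo hd4 hC
  have hcor' : W'.selmerCorank 2 = 0 := by
    rw [selmerCorank_eq_of_variableChange 2 hC, ← selmerCorankTwoInfty_eq]; exact h0
  have har : (W.quadraticTwist (d : ℚ)).analyticRank = 0 := by
    rw [← hC, analyticRank_smul]; exact hConv W' hCM' hgo' hcor'
  obtain ⟨hrank, hsha⟩ := hGZK (W.quadraticTwist (d : ℚ)) (by omega)
  exact ⟨har, by rw [hrank, har], hsha⟩

/-- **On a good twist of corank `≤ 1`, under the crux: the rank-`0` BSD triple is EQUIVALENT to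
`w = +1`.** For `W` as above, `d ≡ 1 (mod 4)`, `corank_{ℤ_2} Sel_{2^∞}(W^{(d)}) ≤ 1`, given
`2`-parity `(−1)^{corank} = w` for every elliptic curve (`hpar`, Dokchitser–Dokchitser Thm. 1.4 at
`p = 2` = Monsky 1996): (`r_an = 0 ∧ rank = 0 ∧ Ш` finite) ↔ `w(W^{(d)}) = +1`. (→) finite `Ш`
gives corank `= rank = 0`, so `w = (−1)^0`; (←) `w = +1` makes the corank even, hence `0`, and §1
applies. [cite: DokchitserDokchitserAnnals2010, Thm. 1.4] [cite: arXiv250317619, Cor. 1.3]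
[cite: GreenbergLNM1716, §1 pp. 54–57] -/
theorem rankZero_bsd_iff_rootNumber_eq_one_of_selmerCorankTwoInfty_le_one
    (hConv : GoodOrdinaryRankZeroTwoConverse) (hGZK : rank_eq_analyticRank_of_analyticRank_le_one)
    (hpar : ∀ (E : WeierstrassCurve ℚ) [E.IsElliptic], p_parity E 2)
    (W : WeierstrassCurve ℚ) [W.IsElliptic] [W.IsGloballyMinimal] (hCM : ¬ W.HasCM)
    (hgo : GoodOrd W 2) {d : ℤ} (hd4 : d % 4 = 1)
    (hle : selmerCorankTwoInfty (W.quadraticTwist d) ≤ 1) :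
    ((W.quadraticTwist d).analyticRank = 0 ∧ (W.quadraticTwist d).mordellWeilRank = 0 ∧
        Finite (W.quadraticTwist d).sha) ↔ (W.quadraticTwist d).rootNumber = 1 := by
  have hd0 : ((d : ℤ) : ℚ) ≠ 0 := by exact_mod_cast (show d ≠ 0 by omega)
  haveI := W.isElliptic_quadraticTwist hd0
  have h2 : (-1 : ℤ) ^ (W.quadraticTwist (d : ℚ)).selmerCorank 2 =
      (W.quadraticTwist (d : ℚ)).rootNumber := hpar _
  rw [← selmerCorankTwoInfty_eq] at h2
  constructor
  · rintro ⟨-, hrank, hsha⟩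
    haveI := hsha
    have hc : selmerCorankTwoInfty (W.quadraticTwist (d : ℚ)) = 0 := by
      rw [selmerCorankTwoInfty_eq,
        selmerCorank_eq_mordellWeilRank_of_finite_shaPrimary _ 2 inferInstance, hrank]
    rw [hc] at h2
    simpa using h2.symm
  · intro hw
    rw [hw] at h2
    have hc1 : selmerCorankTwoInfty (W.quadraticTwist (d : ℚ)) ≠ 1 := fun h1 ↦ by
      rw [h1] at h2
      norm_num at h2
    exact rankZero_bsd_quadraticTwist_of_selmerCorankTwoInfty_eq_zero hConv hGZK W hCM hgo hd4
      (by omega)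

/-! ## §2 From the crux ALONE: the even half of Goldfeld, with BSD, in the good family `𝓕` -/

section RankZero

variable (W : WeierstrassCurve ℚ) [W.IsElliptic] [W.IsGloballyMinimal]

/-- **`100 %` of the even-parity good twists have `ord L = rank = 0` and finite `Ш` (absolute
form).** Under `hConv`, `hGZK`, `2`-parity `hpar` and Smith's Thm. 1.1 for `W` (`hS`): the
squarefree `d` with "`d ≡ 1 (mod 4)` ⟹ `d ≠ 0` ⟹ `w(W^{(d)}) = +1` ⟹
(`ord_{s=1} L(W^{(d)}, s) = 0 ∧ rank W^{(d)}(ℚ) = 0 ∧ Ш(W^{(d)}/ℚ)` finite)" have density `1`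
among all squarefree `d` (the exceptions lie in Smith's density-`0` set `{corank ≥ 2}`).
[cite: arXiv250317619, Thm. 1.1 and Cor. 1.3] [cite: DokchitserDokchitserAnnals2010, Thm. 1.4] -/
theorem twistDensity_rankZero_bsd_of_rootNumber_eq_one
    (hConv : GoodOrdinaryRankZeroTwoConverse) (hGZK : rank_eq_analyticRank_of_analyticRank_le_one)
    (hpar : ∀ (E : WeierstrassCurve ℚ) [E.IsElliptic], p_parity E 2)
    (hCM : ¬ W.HasCM) (hgo : GoodOrd W 2) (hS : smith_selmerCorank_density W) :
    twistDensity (fun d ↦ d % 4 = 1 → d ≠ 0 → (W.quadraticTwist d).rootNumber = 1 →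
      ((W.quadraticTwist d).analyticRank = 0 ∧ (W.quadraticTwist d).mordellWeilRank = 0 ∧
        Finite (W.quadraticTwist d).sha)) 1 :=
  twistDensity_one_mono (fun _ _ hRd hd4 _ hw ↦
      (rankZero_bsd_iff_rootNumber_eq_one_of_selmerCorankTwoInfty_le_one hConv hGZK hpar W hCM hgo
        hd4 hRd.2).mpr hw)
    (twistDensity_selmerCorankTwoInfty_le_one_of W hS)

/-- **Relative form: for `100 %` of `d ∈ 𝓕`, `w(W^{(d)}) = +1 ⟹ ord L = rank = 0 ∧ Ш` finite.**
Same hypotheses; Smith's density-`0` exceptional set is negligible inside `𝓕` because `𝓕` has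
positive lower density (`GoldfeldGoodTwists.tendsto_familyProportion_one_of_twistDensity_zero`).
[cite: arXiv250317619, Thm. 1.1 and Cor. 1.3] [cite: DokchitserDokchitserAnnals2010, Thm. 1.4] -/
theorem tendsto_familyProportion_rankZero_of_rootNumber
    (hConv : GoodOrdinaryRankZeroTwoConverse) (hGZK : rank_eq_analyticRank_of_analyticRank_le_one)
    (hpar : ∀ (E : WeierstrassCurve ℚ) [E.IsElliptic], p_parity E 2)
    (hCM : ¬ W.HasCM) (hgo : GoodOrd W 2) (hS : smith_selmerCorank_density W) :
    Tendsto (fun X : ℕ ↦ (Nat.card {d : ℤ | Squarefree d ∧ |d| ≤ (X : ℤ) ∧ (d % 4 = 1 ∧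
        ((W.quadraticTwist d).rootNumber = 1 →
          ((W.quadraticTwist d).analyticRank = 0 ∧ (W.quadraticTwist d).mordellWeilRank = 0 ∧
            Finite (W.quadraticTwist d).sha)))} : ℝ) /
      Nat.card {d : ℤ | Squarefree d ∧ |d| ≤ (X : ℤ) ∧ d % 4 = 1}) atTop (𝓝 1) := by
  have hR := twistDensity_selmerCorankTwoInfty_le_one_of W hS
  have h0 : twistDensity (fun d ↦ ¬ (d ≠ 0 ∧ selmerCorankTwoInfty (W.quadraticTwist d) ≤ 1)) 0 := by
    simpa using hR.compl
  refine tendsto_familyProportion_one_of_twistDensity_zero (h0.mono_zero fun d _ h hRd ↦ h.2 ?_)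
  exact fun hw ↦ (rankZero_bsd_iff_rootNumber_eq_one_of_selmerCorankTwoInfty_le_one hConv hGZK
    hpar W hCM hgo h.1 hRd.2).mpr hw

/-- **THE EVEN HALF OF GOLDFELD, WITH BSD, IN THE GOOD FAMILY — from the crux alone.** Let
`W / ℚ` be a globally minimal NON-CM elliptic curve with good ordinary reduction at `2`. Assume the
rank-`0` `2`-converse `GoodOrdinaryRankZeroTwoConverse` (`hConv`, item 19218), Gross–Zagier–Kolyvagin
(`hGZK`), `2`-parity (`hpar`), the Modularity Theorem (`hmod`, for the root-number
equidistribution in `𝓕`) and Smith's distribution theorem for `W` (`hS`). Then among the squarefree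
`d ≡ 1 (mod 4)` with `|d| ≤ X`, the proportion of `d` with
`ord_{s=1} L(W^{(d)}, s) = rank W^{(d)}(ℚ) = 0` and `Ш(W^{(d)}/ℚ)` finite tends to EXACTLY `1/2`.
Proof: on Smith's relative-density-`1` set `{corank ≤ 1} ∩ 𝓕` the triple is equivalent to
`w = +1` (`rankZero_bsd_iff_rootNumber_eq_one_of_selmerCorankTwoInfty_le_one`), and `w = +1` for
exactly half of `𝓕` (`GoldfeldGoodTwists.tendsto_familyProportion_rootNumber_eq_one`). The CM
template is Burungale–Tian's Thm. 1.2 (with their rank-zero CM `2`-converse in place of `hConv`).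
[cite: arXiv250317619, Thm. 1.1 and Cor. 1.2] [cite: BurungaleTian2026, Thm. 1.2 and §3.2.1]
[cite: MurtyMurty1997, Ch. 6 §1] [cite: DokchitserDokchitserAnnals2010, Thm. 1.4] -/
theorem tendsto_familyProportion_rankZero
    (hConv : GoodOrdinaryRankZeroTwoConverse) (hGZK : rank_eq_analyticRank_of_analyticRank_le_one)
    (hpar : ∀ (E : WeierstrassCurve ℚ) [E.IsElliptic], p_parity E 2) (hmod : exists_isNewformOf)
    (hCM : ¬ W.HasCM) (hgo : GoodOrd W 2) (hS : smith_selmerCorank_density W) :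
    Tendsto (fun X : ℕ ↦ (Nat.card {d : ℤ | Squarefree d ∧ |d| ≤ (X : ℤ) ∧ (d % 4 = 1 ∧
        ((W.quadraticTwist d).analyticRank = 0 ∧ (W.quadraticTwist d).mordellWeilRank = 0 ∧
          Finite (W.quadraticTwist d).sha))} : ℝ) /
      Nat.card {d : ℤ | Squarefree d ∧ |d| ≤ (X : ℤ) ∧ d % 4 = 1}) atTop (𝓝 (1 / 2)) := by
  have hR := twistDensity_selmerCorankTwoInfty_le_one_of W hS
  have h0 : twistDensity (fun d ↦ ¬ (d ≠ 0 ∧ selmerCorankTwoInfty (W.quadraticTwist d) ≤ 1)) 0 := by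
    simpa using hR.compl
  have hRF : Tendsto (fun X : ℕ ↦ (Nat.card {d : ℤ | Squarefree d ∧ |d| ≤ (X : ℤ) ∧ (d % 4 = 1 ∧
        (d ≠ 0 ∧ selmerCorankTwoInfty (W.quadraticTwist d) ≤ 1))} : ℝ) /
      Nat.card {d : ℤ | Squarefree d ∧ |d| ≤ (X : ℤ) ∧ d % 4 = 1}) atTop (𝓝 1) :=
    tendsto_familyProportion_one_of_twistDensity_zero (h0.mono_zero fun d _ h hRd ↦ h.2 hRd)
  refine tendsto_familyProportion_of_congr_one (tendsto_familyProportion_rootNumber_eq_one W hmod)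
    hRF fun d _ hd4 hRd ↦ ?_
  exact (rankZero_bsd_iff_rootNumber_eq_one_of_selmerCorankTwoInfty_le_one hConv hGZK hpar W hCM
    hgo hd4 hRd.2).symm

/-- The complementary statement: the `d ∈ 𝓕` for which NOT (`ord L = 0 ∧ rank = 0 ∧ Ш` finite)
— up to a relative-density-`0` set, the `d ∈ 𝓕` with `corank_{ℤ_2} Sel_{2^∞}(W^{(d)}) = 1`, i.e.
`w(W^{(d)}) = −1` — are also exactly half of `𝓕`. [cite: arXiv250317619, Thm. 1.1] -/
theorem tendsto_familyProportion_not_rankZero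
    (hConv : GoodOrdinaryRankZeroTwoConverse) (hGZK : rank_eq_analyticRank_of_analyticRank_le_one)
    (hpar : ∀ (E : WeierstrassCurve ℚ) [E.IsElliptic], p_parity E 2) (hmod : exists_isNewformOf)
    (hCM : ¬ W.HasCM) (hgo : GoodOrd W 2) (hS : smith_selmerCorank_density W) :
    Tendsto (fun X : ℕ ↦ (Nat.card {d : ℤ | Squarefree d ∧ |d| ≤ (X : ℤ) ∧ (d % 4 = 1 ∧
        ¬ ((W.quadraticTwist d).analyticRank = 0 ∧ (W.quadraticTwist d).mordellWeilRank = 0 ∧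
          Finite (W.quadraticTwist d).sha))} : ℝ) /
      Nat.card {d : ℤ | Squarefree d ∧ |d| ≤ (X : ℤ) ∧ d % 4 = 1}) atTop (𝓝 (1 / 2)) := by
  have h := tendsto_familyProportion_compl
    (tendsto_familyProportion_rankZero W hConv hGZK hpar hmod hCM hgo hS)
  rwa [sub_half] at h

/-- The `2`-parity input `hpar` taken from its sources in the tree: Monsky's congruence
`corank_{ℤ_2} Sel_{2^∞}(E') ≡ ord_{s=1} L(E', s) (mod 2)` (`hMon`) and the Modularity Theorem
(`hmod`), combined by `p_parity_of_selmerCorank_mod_two_eq_of_exists_isNewformOf`. So the even half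
of Goldfeld with BSD in `𝓕` rests, up to kernel theorems, on: the crux 19218, GZK, Modularity,
Monsky 1996 and Smith 2025 Thm. 1.1 for `W`. [cite: arXiv250317619, Thm. 1.1 and Cor. 1.2]
[cite: DokchitserDokchitserAnnals2010, §4.6 (case p = 2)] [cite: BCDTJAMS2001, Thm. A] -/
theorem tendsto_familyProportion_rankZero_of_monsky
    (hConv : GoodOrdinaryRankZeroTwoConverse) (hGZK : rank_eq_analyticRank_of_analyticRank_le_one)
    (hmod : exists_isNewformOf) (hMon : monsky_selmerCorank_two_mod_two_eq)
    (hCM : ¬ W.HasCM) (hgo : GoodOrd W 2) (hS : smith_selmerCorank_density W) :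
    Tendsto (fun X : ℕ ↦ (Nat.card {d : ℤ | Squarefree d ∧ |d| ≤ (X : ℤ) ∧ (d % 4 = 1 ∧
        ((W.quadraticTwist d).analyticRank = 0 ∧ (W.quadraticTwist d).mordellWeilRank = 0 ∧
          Finite (W.quadraticTwist d).sha))} : ℝ) /
      Nat.card {d : ℤ | Squarefree d ∧ |d| ≤ (X : ℤ) ∧ d % 4 = 1}) atTop (𝓝 (1 / 2)) :=
  tendsto_familyProportion_rankZero W hConv hGZK
    (fun E _ ↦ p_parity_of_selmerCorank_mod_two_eq_of_exists_isNewformOf E 2 hmod (hMon.apply E))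
    hmod hCM hgo hS

end RankZero

/-! ## §3 The same from the K4 halves (the children of the crux) -/

section FromChildren

variable (W : WeierstrassCurve ℚ) [W.IsElliptic] [W.IsGloballyMinimal]

/-- **The crux from its children, restated against the landed constants.** The PUBLISHED
conjunction `Literature.Uncategorized.OrdConversePublishedInputsAtTwo` (item 19167: modularity ∧
Kato 17.4 (1)(2) at `2` ∧ Greenberg Thm. 4.1 parity-free) and the Eisenstein half of the `2`-adic
main conjecture on the class `Theorems.OrdHalvesAtTwo.OrdEisensteinHalfAtTwo` (item 19151, OPEN)
give `GoodOrdinaryRankZeroTwoConverse` — the landed bridge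
`goodOrdinaryRankZeroTwoConverse_of_facts_of_eisenstein` (p409493; the route's glue item 19168 is
the same statement on the route decls, p416617). [cite: GreenbergLNM1716, Thm. 4.1 (p. 102)]
[cite: Kato2004Asterisque, Thm. 17.4 (1) (p. 273)] -/
theorem goodOrdinaryRankZeroTwoConverse_of_children
    (hP : Literature.Uncategorized.OrdConversePublishedInputsAtTwo)
    (hE : Summit.BirchSwinnertonDyer.BirchSwinnertonDyer.Theorems.OrdHalvesAtTwo.OrdEisensteinHalfAtTwo) :
    GoodOrdinaryRankZeroTwoConverse := by
  obtain ⟨hmod, h17, hGr⟩ := hP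
  exact goodOrdinaryRankZeroTwoConverse_of_facts_of_eisenstein hmod h17 hGr
    (fun V _ _ hcm hgo ↦ hE V hcm hgo)

/-- **The even half of Goldfeld with BSD in `𝓕`, from the K4 halves.** As
`tendsto_familyProportion_rankZero_of_monsky`, with the crux replaced by its two children: the
PUBLISHED inputs (`hP`) and the Eisenstein half of the `2`-adic main conjecture on the class (`hE`,
OPEN) — so the statement rests on ONE open object, `X5.O1.MainConjectureEisensteinDivisibilityAtTwo`
∀-closed over non-CM curves good ordinary at `2`, plus named facts (Kato 17.4@2, Greenberg 4.1,
Modularity, GZK, Monsky, Smith Thm. 1.1 for `W`). [cite: arXiv250317619, Thm. 1.1 and Cor. 1.2]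
[cite: GreenbergLNM1716, Thm. 4.1 (p. 102)] [cite: SkinnerUrban2014, Thm. 3.6.11 (shape; p odd)] -/
theorem tendsto_familyProportion_rankZero_of_eisensteinHalf
    (hP : Literature.Uncategorized.OrdConversePublishedInputsAtTwo)
    (hE : Summit.BirchSwinnertonDyer.BirchSwinnertonDyer.Theorems.OrdHalvesAtTwo.OrdEisensteinHalfAtTwo)
    (hGZK : rank_eq_analyticRank_of_analyticRank_le_one)
    (hmod : exists_isNewformOf) (hMon : monsky_selmerCorank_two_mod_two_eq)
    (hCM : ¬ W.HasCM) (hgo : GoodOrd W 2) (hS : smith_selmerCorank_density W) :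
    Tendsto (fun X : ℕ ↦ (Nat.card {d : ℤ | Squarefree d ∧ |d| ≤ (X : ℤ) ∧ (d % 4 = 1 ∧
        ((W.quadraticTwist d).analyticRank = 0 ∧ (W.quadraticTwist d).mordellWeilRank = 0 ∧
          Finite (W.quadraticTwist d).sha))} : ℝ) /
      Nat.card {d : ℤ | Squarefree d ∧ |d| ≤ (X : ℤ) ∧ d % 4 = 1}) atTop (𝓝 (1 / 2)) :=
  tendsto_familyProportion_rankZero_of_monsky W (goodOrdinaryRankZeroTwoConverse_of_children hP hE)
    hGZK hmod hMon hCM hgo hS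

/-- For `100 %` of `d ∈ 𝓕`: `w(W^{(d)}) = +1 ⟹ ord L = rank = 0 ∧ Ш` finite — from the K4 halves
(PUBLISHED inputs + Eisenstein half), GZK, Modularity, Monsky, Smith.
[cite: arXiv250317619, Thm. 1.1 and Cor. 1.3] [cite: GreenbergLNM1716, Thm. 4.1 (p. 102)] -/
theorem tendsto_familyProportion_rankZero_of_rootNumber_of_eisensteinHalf
    (hP : Literature.Uncategorized.OrdConversePublishedInputsAtTwo)
    (hE : Summit.BirchSwinnertonDyer.BirchSwinnertonDyer.Theorems.OrdHalvesAtTwo.OrdEisensteinHalfAtTwo)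
    (hGZK : rank_eq_analyticRank_of_analyticRank_le_one)
    (hmod : exists_isNewformOf) (hMon : monsky_selmerCorank_two_mod_two_eq)
    (hCM : ¬ W.HasCM) (hgo : GoodOrd W 2) (hS : smith_selmerCorank_density W) :
    Tendsto (fun X : ℕ ↦ (Nat.card {d : ℤ | Squarefree d ∧ |d| ≤ (X : ℤ) ∧ (d % 4 = 1 ∧
        ((W.quadraticTwist d).rootNumber = 1 →
          ((W.quadraticTwist d).analyticRank = 0 ∧ (W.quadraticTwist d).mordellWeilRank = 0 ∧
            Finite (W.quadraticTwist d).sha)))} : ℝ) /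
      Nat.card {d : ℤ | Squarefree d ∧ |d| ≤ (X : ℤ) ∧ d % 4 = 1}) atTop (𝓝 1) :=
  tendsto_familyProportion_rankZero_of_rootNumber W
    (goodOrdinaryRankZeroTwoConverse_of_children hP hE) hGZK
    (fun E _ ↦ p_parity_of_selmerCorank_mod_two_eq_of_exists_isNewformOf E 2 hmod (hMon.apply E))
    hCM hgo hS

end FromChildren

end Summit.BirchSwinnertonDyer.BirchSwinnertonDyer.Theorems.TwoAdicGoodTwists

end
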